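import Summits.CriticalPhenomena.PercolationContinuityZ3.Theorems.FK.SamePPinnedDomination
import HarnessLib

/-!
# FK-continuity transplant, FO-11 (3d/4, part i): the pinned law of a region after a history — weights,
# almost-sure pins, and the reduction of region-determined bad events to fresh-determined ones

Cell `fk-continuity` (bschramm), row FO-11 (C2); support file for the FK-continuity transplant
(`--supports stmt-CriticalPhenomena-4575`); builds on p205010 (kernel theorem, internal audit signed; external
expert review pending).  No named facts, no sorries, standard axioms.

For a history-driven scheme `S : HSiteScheme (Site d)`, a history `h`, a lattice parameter `p` and a finite region `R`,
the MINIMAL weighting `SameP.pinnedW S p h R` (Kozma–Nitzan's `Wfull`; cell row FO-05's `FKScheme.minW`, definitionally,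
once `revealed = U₀ ∪ supp h`, `pattern = U₀ ∪ opens h` are unfolded) gives weight `p` to the FRESH lattice edges of
`R` (`SameP.freshOf S h R = E_R ∖ (U₀ ∪ supp h)`), `1` to the revealed pairs of `R` recorded open, `0` to the revealed
pairs recorded closed and to every pair off `R`; `SameP.pinnedLaw S q p h R = fkLaw R (pinnedW S p h R) q`.  Proved here:
the weight lemmas (inputs `hWF/hWI/hWR` of `IsBoxLimit.real_inter_le_fkLaw_mul`, file 3c, and "the weights at two
parameters differ only on the fresh edges"); ALMOST-SURE PINS under `fkLaw` (a weight-`0` pair is a.s. closed, a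
weight-`1` pair of `R` a.s. open), whence the pinned law does not distinguish an `E_R`-determined event `D` from its
FRESH REDUCTION `SameP.pinReduce` ("`(ω ∩ fresh) ∪ pattern ∈ D`", decreasing with `D`, determined by the fresh edges:
`pinnedLaw_real_pinReduce_eq`); and on the past `A₀ ∩ {hist n = h}` the two events coincide
(`inter_pinReduce_eq_inter`), since along a history the revealed pairs are pinned to the recorded pattern
(`mem_iff_mem_opens_of_hist_eq`).  So C1's bad events ("determined by the lattice edges of the region", row FO-05)
feed the DLR step of file 3c, which wants fresh-determined events.

## References

* G. Kozma, S. Nitzan, arXiv:2401.12397 (2024), §4 p. 28 (`Ω`, `P_{R_x,h}`), pp. 20–22. [KozmaNitzan2024]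
* G. Grimmett, *The Random-Cluster Model*, Springer 2006, §1.4 (1.20), Thm (3.7) p. 39. [Grimmett2006]
-/
noncomputable section

namespace Summit.CriticalPhenomena.PercolationContinuityZ3.Theorems.FK

open MeasureTheory Filter Literature.Probability.Percolation Literature.Probability.LatticeModels
open Literature.Probability.Percolation.ProbeHistory Literature.Probability.Percolation.KozmaNitzan
open scoped ENNReal Classical Topology

namespace SameP

variable {d : ℕ}

/-! ### The pinned weighting -/

/-- The revealed pairs after a history: the initial edges and everything examined. [cite: KozmaNitzan2024, §4 p. 26] -/
def revealedOf (S : HSiteScheme (Site d)) (h : ProbeHistory (Site d)) : Finset (Sym2 (Site d)) := S.U₀ ∪ supp h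

/-- The recorded open pattern after a history: the initial edges and the examined edges found open.
[cite: KozmaNitzan2024, §4 p. 26] -/
def patternOf (S : HSiteScheme (Site d)) (h : ProbeHistory (Site d)) : Finset (Sym2 (Site d)) := S.U₀ ∪ opens h

/-- The fresh lattice edges of the region `R` after the history `h`. [cite: KozmaNitzan2024, §4 p. 28] -/
def freshOf (S : HSiteScheme (Site d)) (h : ProbeHistory (Site d)) (R : Finset (Site d)) : Finset (Sym2 (Site d)) :=
  edgesIn (zdGraph d) R \ revealedOf S h

/-- **The minimal (pinned) weighting** of the region `R` after `h` at lattice parameter `p`: `p` on the fresh lattice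
edges, revealed pairs pinned to the recorded pattern, everything off `R` deleted (Kozma–Nitzan's `Wfull`; cell row
FO-05's `FKScheme.minW`). [cite: KozmaNitzan2024, §4 p. 28 (Ω, P_{R_x,h})] -/
def pinnedW (S : HSiteScheme (Site d)) (p : unitInterval) (h : ProbeHistory (Site d)) (R : Finset (Site d)) :
    Sym2 (Site d) → unitInterval :=
  restrW (↑R : Set (Site d)) (pinW (lattW d p) ↑(revealedOf S h) ↑(patternOf S h))

/-- **The pinned law** of the region `R` after `h`: the random-cluster measure with the minimal weighting, read on
`ℤ^d` (cell `fkLaw`). [cite: KozmaNitzan2024, §4 p. 28 (P_{R_x,h})] -/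
def pinnedLaw (S : HSiteScheme (Site d)) (q : ℝ) (p : unitInterval) (h : ProbeHistory (Site d))
    (R : Finset (Site d)) : Measure (BondConfig (Site d)) :=
  fkLaw R (pinnedW S p h R) q

variable {S : HSiteScheme (Site d)} {p : unitInterval} {h : ProbeHistory (Site d)} {R : Finset (Site d)}

/-- The fresh edges are lattice edges. [folklore] -/
theorem freshOf_subset_edgeSet : (↑(freshOf S h R) : Set (Sym2 (Site d))) ⊆ (zdGraph d).edgeSet := by
  intro e he
  have := Finset.mem_coe.1 he
  rw [freshOf, Finset.mem_sdiff, mem_edgesIn_iff] at this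
  exact this.1.1

/-- The fresh edges avoid the revealed pairs. [folklore] -/
theorem disjoint_revealed_freshOf : Disjoint (S.U₀ ∪ supp h) (freshOf S h R) := by
  rw [freshOf, revealedOf]; exact Finset.disjoint_sdiff

/-- A lattice edge inside `R` lies in `E_R`. [folklore] -/
theorem mem_edgesIn_of_mem_wireSet {e : Sym2 (Site d)} (he : e ∈ wireSet (↑R : Set (Site d)))
    (hG : e ∈ (zdGraph d).edgeSet) : e ∈ edgesIn (zdGraph d) R :=
  mem_edgesIn_iff.2 ⟨hG, fun x hx => Finset.mem_coe.1 (he.1 x hx)⟩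

/-- An edge of `E_R` is a pair of distinct vertices of `R`. [folklore] -/
theorem mem_wireSet_of_mem_edgesIn {e : Sym2 (Site d)} (he : e ∈ edgesIn (zdGraph d) R) :
    e ∈ wireSet (↑R : Set (Site d)) := by
  rw [mem_edgesIn_iff] at he
  exact ⟨fun x hx => Finset.mem_coe.2 (he.2 x hx), SimpleGraph.not_isDiag_of_mem_edgeSet _ he.1⟩

/-- Off the pairs of `R` the pinned weight is `0`. [folklore] -/
theorem pinnedW_eq_zero_of_not_mem_wireSet {e : Sym2 (Site d)} (he : e ∉ wireSet (↑R : Set (Site d))) :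
    pinnedW S p h R e = 0 := by
  unfold pinnedW; exact restrW_apply_of_not_mem _ he

/-- A revealed pair of `R` on the recorded pattern has weight `1`. [folklore] -/
theorem pinnedW_eq_one_of_mem_patternOf {e : Sym2 (Site d)} (he : e ∈ wireSet (↑R : Set (Site d)))
    (hr : e ∈ revealedOf S h) (hx : e ∈ patternOf S h) : pinnedW S p h R e = 1 := by
  unfold pinnedW; rw [restrW_apply_of_mem _ he]
  exact pinW_apply_of_mem_of_mem _ (Finset.mem_coe.2 hr) (Finset.mem_coe.2 hx)

/-- A revealed pair of `R` off the recorded pattern has weight `0`. [folklore] -/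
theorem pinnedW_eq_zero_of_not_mem_patternOf {e : Sym2 (Site d)} (he : e ∈ wireSet (↑R : Set (Site d)))
    (hr : e ∈ revealedOf S h) (hx : e ∉ patternOf S h) : pinnedW S p h R e = 0 := by
  unfold pinnedW; rw [restrW_apply_of_mem _ he]
  exact pinW_apply_of_mem_of_not_mem _ (Finset.mem_coe.2 hr) (mt Finset.mem_coe.1 hx)

/-- An unrevealed pair of `R` carries the lattice weight. [folklore] -/
theorem pinnedW_eq_lattW_of_not_mem_revealedOf {e : Sym2 (Site d)} (he : e ∈ wireSet (↑R : Set (Site d)))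
    (hr : e ∉ revealedOf S h) : pinnedW S p h R e = lattW d p e := by
  unfold pinnedW; rw [restrW_apply_of_mem _ he]
  exact pinW_apply_of_not_mem _ _ (mt Finset.mem_coe.1 hr)

/-- On a fresh lattice edge the pinned weight is the parameter `p`. [folklore] -/
theorem pinnedW_apply_of_mem_freshOf {e : Sym2 (Site d)} (he : e ∈ freshOf S h R) : pinnedW S p h R e = p := by
  rw [freshOf, Finset.mem_sdiff] at he
  rw [pinnedW_eq_lattW_of_not_mem_revealedOf (mem_wireSet_of_mem_edgesIn he.1) he.2, lattW_apply,
    if_pos (mem_edgesIn_iff.1 he.1).1]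

/-- A pair of nonzero pinned weight off the fresh edges lies on the recorded pattern. [folklore] -/
theorem mem_patternOf_of_pinnedW_ne_zero {e : Sym2 (Site d)} (hf : e ∉ freshOf S h R)
    (hne : pinnedW S p h R e ≠ 0) : e ∈ patternOf S h := by
  by_cases hw : e ∈ wireSet (↑R : Set (Site d))
  · by_cases hr : e ∈ revealedOf S h
    · by_contra hx
      exact hne (pinnedW_eq_zero_of_not_mem_patternOf hw hr hx)
    · exfalso
      rw [pinnedW_eq_lattW_of_not_mem_revealedOf hw hr, lattW_apply] at hne
      by_cases hG : e ∈ (zdGraph d).edgeSet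
      · exact hf (by rw [freshOf, Finset.mem_sdiff]; exact ⟨mem_edgesIn_of_mem_wireSet hw hG, hr⟩)
      · rw [if_neg hG] at hne; exact hne rfl
  · exact absurd (pinnedW_eq_zero_of_not_mem_wireSet hw) hne

/-- A pair of nonzero pinned weight lies inside `R`. [folklore] -/
theorem forall_mem_of_pinnedW_ne_zero {e : Sym2 (Site d)} (hne : pinnedW S p h R e ≠ 0) : ∀ x ∈ e, x ∈ R := by
  by_cases hw : e ∈ wireSet (↑R : Set (Site d))
  · exact fun x hx => Finset.mem_coe.1 (hw.1 x hx)
  · exact absurd (pinnedW_eq_zero_of_not_mem_wireSet hw) hne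

/-- **The pinned weights at two parameters differ only on the fresh edges.** [folklore] -/
theorem pinnedW_congr_of_not_mem_freshOf {p' : unitInterval} {e : Sym2 (Site d)} (hf : e ∉ freshOf S h R) :
    pinnedW S p h R e = pinnedW S p' h R e := by
  by_cases hw : e ∈ wireSet (↑R : Set (Site d))
  · by_cases hr : e ∈ revealedOf S h
    · by_cases hx : e ∈ patternOf S h
      · rw [pinnedW_eq_one_of_mem_patternOf hw hr hx, pinnedW_eq_one_of_mem_patternOf hw hr hx]
      · rw [pinnedW_eq_zero_of_not_mem_patternOf hw hr hx, pinnedW_eq_zero_of_not_mem_patternOf hw hr hx]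
    · have hG : e ∉ (zdGraph d).edgeSet := fun hG =>
        hf (by rw [freshOf, Finset.mem_sdiff]; exact ⟨mem_edgesIn_of_mem_wireSet hw hG, hr⟩)
      rw [pinnedW_eq_lattW_of_not_mem_revealedOf hw hr, pinnedW_eq_lattW_of_not_mem_revealedOf hw hr,
        lattW_apply, lattW_apply, if_neg hG, if_neg hG]
  · rw [pinnedW_eq_zero_of_not_mem_wireSet hw, pinnedW_eq_zero_of_not_mem_wireSet hw]

/-! ### Almost-sure pins under `fkLaw` -/

section Pins

variable (R) (W : Sym2 (Site d) → unitInterval) {q : ℝ}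

/-- A weight-`0` pair that is open kills the random-cluster weight (local copy). [cite: Grimmett2006, §1.4 eq. (1.20)] -/
private theorem rcWeightW_eq_zero_of_zero_mem' {V : Type*} [Fintype V] (w : Sym2 V → unitInterval) (q : ℝ)
    (B : Set V) {e : Sym2 V} {ω : BondConfig V} (h0 : (w e : ℝ) = 0) (he : e ∈ ω) : rcWeightW w q B ω = 0 := by
  classical
  unfold rcWeightW BHK2006.weight
  rw [Finset.prod_eq_zero (Finset.mem_univ e) (by simp only [if_pos he, h0]), zero_mul]

/-- A weight-`1` pair that is closed kills the random-cluster weight (local copy). [cite: Grimmett2006, §1.4 eq. (1.20)] -/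
private theorem rcWeightW_eq_zero_of_one_not_mem' {V : Type*} [Fintype V] (w : Sym2 V → unitInterval) (q : ℝ)
    (B : Set V) {e : Sym2 V} {ω : BondConfig V} (h1 : (w e : ℝ) = 1) (he : e ∉ ω) : rcWeightW w q B ω = 0 := by
  classical
  unfold rcWeightW BHK2006.weight
  rw [Finset.prod_eq_zero (Finset.mem_univ e) (by simp only [if_neg he, h1]; ring), zero_mul]

/-- An event all of whose configurations have zero random-cluster weight is null. [cite: Grimmett2006, §1.4 eq. (1.20)] -/
theorem rcMeasureW_real_eq_zero_of_forall {V : Type*} [Fintype V] (w : Sym2 V → unitInterval) {q : ℝ} (hq : 0 < q)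
    (B : Set V) {A : Set (BondConfig V)} (hA : ∀ ω ∈ A, rcWeightW w q B ω = 0) : (rcMeasureW w q B).real A = 0 := by
  rw [rcMeasureW_real_apply w hq B A]
  refine Finset.sum_eq_zero fun ω _ => ?_
  by_cases hω : ω ∈ A
  · rw [if_pos hω, hA ω hω, zero_div]
  · rw [if_neg hω]

/-- The event "the pair `e` is open" is determined by `{e}`, hence measurable. [folklore] -/
theorem measurableSet_setOf_mem (e : Sym2 (Site d)) : MeasurableSet {ω : BondConfig (Site d) | e ∈ ω} := by
  refine DeterminedBy.measurableSet_of_finset (F := {e}) ((determinedBy_iff _ _).2 fun ω ω' hωω' => ?_)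
  simp only [Set.mem_setOf_eq]
  constructor
  · intro he; exact ((Set.ext_iff.1 hωω' e).1 ⟨he, by simp⟩).1
  · intro he; exact ((Set.ext_iff.1 hωω' e).2 ⟨he, by simp⟩).1

/-- **A weight-`0` pair is almost surely closed** under `fkLaw R W q`. [cite: Grimmett2006, §1.4 eq. (1.20)] -/
theorem fkLaw_real_setOf_mem_eq_zero (hq : 0 < q) {e : Sym2 (Site d)} (hW : W e = 0) :
    (fkLaw R W q).real {ω | e ∈ ω} = 0 := by
  rw [fkLaw, map_measureReal_apply (measurable_liftEdges R) (measurableSet_setOf_mem e)]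
  refine rcMeasureW_real_eq_zero_of_forall _ hq ∅ fun ω hω => ?_
  obtain ⟨e', he', hee'⟩ := mem_liftEdges_iff.1 (show e ∈ liftEdges R ω from hω)
  exact rcWeightW_eq_zero_of_zero_mem' _ q ∅ (e := e') (by rw [hee', hW]; rfl) he'

/-- **A weight-`1` pair of `R` is almost surely open** under `fkLaw R W q`. [cite: Grimmett2006, §1.4 eq. (1.20)] -/
theorem fkLaw_real_setOf_not_mem_eq_zero (hq : 0 < q) {e : Sym2 (Site d)} (he : e ∈ wireSet (↑R : Set (Site d)))
    (hW : W e = 1) : (fkLaw R W q).real {ω | e ∉ ω} = 0 := by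
  have hmeas : MeasurableSet {ω : BondConfig (Site d) | e ∉ ω} := (measurableSet_setOf_mem e).compl
  rw [fkLaw, map_measureReal_apply (measurable_liftEdges R) hmeas]
  refine rcMeasureW_real_eq_zero_of_forall _ hq ∅ fun ω hω => ?_
  -- `e` is the image of a pair of `R`
  obtain ⟨e₀, he₀⟩ : ∃ e₀ : Sym2 ↥R, Sym2.map Subtype.val e₀ = e := by
    induction e using Sym2.ind with
    | h x y => exact ⟨s(⟨x, Finset.mem_coe.1 (he.1 x (by simp))⟩, ⟨y, Finset.mem_coe.1 (he.1 y (by simp))⟩), by simp⟩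
  have hne : e₀ ∉ ω := fun h' => hω (mem_liftEdges_iff.2 ⟨e₀, h', he₀⟩)
  exact rcWeightW_eq_zero_of_one_not_mem' _ q ∅ (e := e₀) (by rw [he₀, hW]; rfl) hne

/-- **The pin cylinder has full pinned measure**: if `W = 1` on `π` and `W = 0` on `K ∖ π` for finite sets
`π ⊆ K ⊆ wireSet R`, then `fkLaw R W q`-a.s. `ω ∩ K = π`. [cite: Grimmett2006, §1.4 eq. (1.20)] -/
theorem fkLaw_compl_pinCyl_eq_zero (hq : 0 < q) {K π : Finset (Sym2 (Site d))}
    (hK : ∀ e ∈ K, e ∈ wireSet (↑R : Set (Site d))) (h1 : ∀ e ∈ π, W e = 1) (h0 : ∀ e ∈ K, e ∉ π → W e = 0) :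
    fkLaw R W q {ω | ∀ e ∈ K, e ∈ ω ↔ e ∈ π}ᶜ = 0 := by
  haveI : IsFiniteMeasure (fkLaw R W q) := by
    rw [fkLaw]; haveI := isProbabilityMeasure_rcMeasureW (fun e : Sym2 ↥R => W (Sym2.map Subtype.val e)) hq ∅
    infer_instance
  have hsub : {ω : BondConfig (Site d) | ∀ e ∈ K, e ∈ ω ↔ e ∈ π}ᶜ ⊆
      ⋃ e ∈ K, (if e ∈ π then {ω | e ∉ ω} else {ω | e ∈ ω}) := by
    intro ω hω
    simp only [Set.mem_compl_iff, Set.mem_setOf_eq, not_forall] at hω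
    obtain ⟨e, heK, hiff⟩ := hω
    refine Set.mem_iUnion₂.2 ⟨e, heK, ?_⟩
    by_cases heπ : e ∈ π
    · rw [if_pos heπ]; exact fun heω => hiff ⟨fun _ => heπ, fun _ => heω⟩
    · rw [if_neg heπ]
      by_contra heω
      exact hiff ⟨fun h => absurd h heω, fun h => absurd h heπ⟩
  refine measure_mono_null hsub ((measure_biUnion_null_iff K.countable_toSet).2 fun e heK => ?_)
  by_cases heπ : e ∈ π
  · rw [if_pos heπ]
    exact (measureReal_eq_zero_iff (measure_ne_top _ _)).1
      (fkLaw_real_setOf_not_mem_eq_zero R W hq (hK e heK) (h1 e heπ))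
  · rw [if_neg heπ]
    exact (measureReal_eq_zero_iff (measure_ne_top _ _)).1 (fkLaw_real_setOf_mem_eq_zero R W hq (h0 e heK heπ))

end Pins

/-! ### The fresh reduction of a region-determined event -/

/-- **Fresh reduction** of an event along the pinned pairs: "`(ω ∩ F) ∪ π ∈ D`". [folklore] -/
def pinReduce (F π : Finset (Sym2 (Site d))) (D : Set (BondConfig (Site d))) : Set (BondConfig (Site d)) :=
  {ω | ω ∩ ↑F ∪ ↑π ∈ D}

/-- The fresh reduction is determined by `F`. [folklore] -/
theorem determinedBy_pinReduce (F π : Finset (Sym2 (Site d))) (D : Set (BondConfig (Site d))) :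
    DeterminedBy (pinReduce F π D) ↑F := by
  rw [determinedBy_iff]
  intro ω ω' h
  simp only [pinReduce, Set.mem_setOf_eq, h]

/-- The fresh reduction of a decreasing event is decreasing. [folklore] -/
theorem isLowerSet_pinReduce (F π : Finset (Sym2 (Site d))) {D : Set (BondConfig (Site d))} (hD : IsLowerSet D) :
    IsLowerSet (pinReduce F π D) := fun _ _ hle hω =>
  hD (Set.union_subset_union_left _ (Set.inter_subset_inter_left _ hle)) hω

/-- On a configuration pinned to `π` on `K ∖ F`-part, a `K`-determined event agrees with its fresh reduction
(`F = K ∖ K'`, `π ⊆ K' ⊆ K`). [folklore] -/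
theorem mem_iff_mem_pinReduce {K K' π : Finset (Sym2 (Site d))} {D : Set (BondConfig (Site d))}
    (hD : DeterminedBy D ↑K) (hπ : π ⊆ K') {ω : BondConfig (Site d)}
    (hω : ∀ e ∈ K', e ∈ ω ↔ e ∈ π) : ω ∈ D ↔ ω ∈ pinReduce (K \ K') π D := by
  simp only [pinReduce, Set.mem_setOf_eq]
  refine (determinedBy_iff _ _).1 hD _ _ (Set.ext fun e => ?_)
  simp only [Set.mem_inter_iff, Set.mem_union, Finset.coe_sdiff, Set.mem_sdiff, Finset.mem_coe]
  constructor
  · rintro ⟨heω, heK⟩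
    by_cases heK' : e ∈ K'
    · exact ⟨Or.inr ((hω e heK').1 heω), heK⟩
    · exact ⟨Or.inl ⟨heω, heK, heK'⟩, heK⟩
  · rintro ⟨h | h, heK⟩
    · exact ⟨h.1, heK⟩
    · exact ⟨(hω e (hπ h)).2 h, heK⟩

/-- **The pinned law does not distinguish an `E_R`-determined event from its fresh reduction**: with
`K' = E_R ∩ (U₀ ∪ supp h)` (revealed edges of the region) and `π = K' ∩ (U₀ ∪ opens h)` (those recorded open),
`pinnedLaw(D) = pinnedLaw(pinReduce (freshOf S h R) π D)`. [cite: Grimmett2006, Thm (3.7) p. 39] -/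
theorem pinnedLaw_real_pinReduce_eq {q : ℝ} (hq : 0 < q) {D : Set (BondConfig (Site d))}
    (hD : DeterminedBy D ↑(edgesIn (zdGraph d) R)) :
    (pinnedLaw S q p h R).real
        (pinReduce (freshOf S h R) (edgesIn (zdGraph d) R ∩ revealedOf S h ∩ patternOf S h) D) =
      (pinnedLaw S q p h R).real D := by
  set K := edgesIn (zdGraph d) R with hK
  set K' := K ∩ revealedOf S h with hK'
  set π := K ∩ revealedOf S h ∩ patternOf S h with hπ
  have hπK' : π ⊆ K' := Finset.inter_subset_left
  have hF : freshOf S h R = K \ K' := by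
    ext e; simp only [freshOf, hK', Finset.mem_sdiff, Finset.mem_inter, not_and]
    constructor
    · rintro ⟨heK, hr⟩; exact ⟨heK, fun _ => hr⟩
    · rintro ⟨heK, h⟩; exact ⟨heK, h heK⟩
  -- the pin cylinder is almost sure under the pinned law
  have hnull : pinnedLaw S q p h R {ω | ∀ e ∈ K', e ∈ ω ↔ e ∈ π}ᶜ = 0 := by
    refine fkLaw_compl_pinCyl_eq_zero R (pinnedW S p h R) hq
      (fun e he => mem_wireSet_of_mem_edgesIn (Finset.mem_inter.1 he).1) (fun e he => ?_) (fun e he hne => ?_)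
    · obtain ⟨he1, he2⟩ := Finset.mem_inter.1 he
      obtain ⟨heK, her⟩ := Finset.mem_inter.1 he1
      exact pinnedW_eq_one_of_mem_patternOf (mem_wireSet_of_mem_edgesIn heK) her he2
    · obtain ⟨heK, her⟩ := Finset.mem_inter.1 he
      exact pinnedW_eq_zero_of_not_mem_patternOf (mem_wireSet_of_mem_edgesIn heK) her
        (fun hx => hne (Finset.mem_inter.2 ⟨he, hx⟩))
  refine measureReal_congr (ae_eq_set.2 ⟨measure_mono_null ?_ hnull, measure_mono_null ?_ hnull⟩)
  · intro ω hω
    obtain ⟨hω1, hω2⟩ := hω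
    intro hpin
    exact hω2 ((mem_iff_mem_pinReduce hD hπK' hpin).2 (hF ▸ hω1))
  · intro ω hω
    obtain ⟨hω1, hω2⟩ := hω
    intro hpin
    exact hω2 (hF ▸ (mem_iff_mem_pinReduce hD hπK' hpin).1 hω1)

/-! ### Along a history the revealed pairs are pinned to the recorded pattern -/

/-- Along a history of an adaptive explorer, a revealed pair is open iff it was recorded open:
`hist n ω = h ⇒ ∀ e ∈ supp h, (e ∈ ω ↔ e ∈ opens h)`. [folklore] -/
theorem mem_iff_mem_opens_of_hist_eq {V : Type*} (E : AExplorer V) {n : ℕ} {h : ProbeHistory V}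
    {ω : BondConfig V} (hh : E.hist n ω = h) {e : Sym2 V} (he : e ∈ supp h) : e ∈ ω ↔ e ∈ opens h := by
  induction n generalizing h with
  | zero => subst hh; simp [AExplorer.hist_zero] at he
  | succ n ih =>
    subst hh
    rw [AExplorer.hist_succ] at he ⊢
    cases hD : E.next (E.hist n ω) with
    | none =>
      rw [E.step_of_none hD, supp_cons_none] at he
      rw [E.step_of_none hD, KozmaNitzan.opens_cons_none]
      exact ih rfl he
    | some P =>
      rw [E.step_of_some hD, supp_cons_some] at he
      rw [E.step_of_some hD, KozmaNitzan.opens_cons_some, Finset.mem_union]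
      rcases Finset.mem_union.1 he with he1 | he2
      · -- `e` examined by the new probe: open iff read
        have hread : e ∈ (P.record ω).2 ↔ e ∈ ω := by
          simp only [AProbe.record, AProbe.read, obs, Finset.mem_filter]
          exact ⟨fun h => h.2, fun h => ⟨he1, h⟩⟩
        constructor
        · exact fun heω => Or.inl (hread.2 heω)
        · rintro (h1 | h2)
          · exact hread.1 h1
          · exact (opens_subset_of_hist_eq E rfl) h2
      · rw [ih rfl he2]
        constructor
        · exact fun h => Or.inr h
        · rintro (h1 | h2)
          · have : e ∈ ω := by
              simp only [AProbe.record, AProbe.read, obs, Finset.mem_filter] at h1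
              exact h1.2
            exact (ih rfl he2).1 this
          · exact h2

/-- **On the past, a region-determined event coincides with its fresh reduction**: for `ω ∈ A₀ ∩ {hist n = h}`
the revealed edges of the region are open exactly on the recorded pattern, so `ω ∈ D ↔ ω ∈ pinReduce … D`.
[cite: KozmaNitzan2024, §4 p. 26 (ω|_{E_i})] -/
theorem inter_pinReduce_eq_inter (S : HSiteScheme (Site d)) (n : ℕ) (h : ProbeHistory (Site d)) (R : Finset (Site d))
    {D : Set (BondConfig (Site d))} (hD : DeterminedBy D ↑(edgesIn (zdGraph d) R)) :
    pinReduce (freshOf S h R) (edgesIn (zdGraph d) R ∩ revealedOf S h ∩ patternOf S h) D ∩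
        (S.initEvent ∩ {ω | S.E.hist n ω = h}) =
      D ∩ (S.initEvent ∩ {ω | S.E.hist n ω = h}) := by
  set K := edgesIn (zdGraph d) R with hK
  set K' := K ∩ revealedOf S h with hK'
  set π := K ∩ revealedOf S h ∩ patternOf S h with hπ
  have hF : freshOf S h R = K \ K' := by
    ext e; simp only [freshOf, hK', Finset.mem_sdiff, Finset.mem_inter, not_and]
    constructor
    · rintro ⟨heK, hr⟩; exact ⟨heK, fun _ => hr⟩
    · rintro ⟨heK, h⟩; exact ⟨heK, h heK⟩
  have hpin : ∀ {ω : BondConfig (Site d)}, ω ∈ S.initEvent → S.E.hist n ω = h →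
      ∀ e ∈ K', e ∈ ω ↔ e ∈ π := fun {ω} hA hh e he => by
    obtain ⟨heK, her⟩ := Finset.mem_inter.1 he
    rw [hπ, Finset.mem_inter, and_iff_right he, patternOf, Finset.mem_union]
    rcases Finset.mem_union.1 (show e ∈ S.U₀ ∪ supp h from her) with hU | hs
    · exact ⟨fun _ => Or.inl hU, fun _ => hA (Finset.mem_coe.2 hU)⟩
    · rw [mem_iff_mem_opens_of_hist_eq S.E hh hs]
      exact ⟨fun h' => Or.inr h', fun h' => h'.elim
        (fun hU => (mem_iff_mem_opens_of_hist_eq S.E hh hs).1 (hA (Finset.mem_coe.2 hU))) id⟩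
  ext ω
  simp only [Set.mem_inter_iff]
  constructor
  · rintro ⟨hω, hA, hh⟩
    exact ⟨(mem_iff_mem_pinReduce hD Finset.inter_subset_left (hpin hA hh)).2 (hF ▸ hω), hA, hh⟩
  · rintro ⟨hω, hA, hh⟩
    exact ⟨hF ▸ (mem_iff_mem_pinReduce hD Finset.inter_subset_left (hpin hA hh)).1 hω, hA, hh⟩

end SameP

end Summit.CriticalPhenomena.PercolationContinuityZ3.Theorems.FK

end
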